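import Summits.BirchSwinnertonDyer.BirchSwinnertonDyer.Theorems.CMKolyvaginAtInertTwoAdaptiveStep
import HarnessLib

/-!
# Route `CMKolyvaginAtInertTwo`, crux `CMKolyvaginExactAtInertTwo` (stmt-BirchSwinnertonDyer-24277):
# ALGEBRA OF THE ORDER-FORM ČEBOTAREV BINDER AT `2` (T4c, pure part)

Seat `bsd-line-cmk2-p1` g13 (cell `bsd-print-cf2`); helper (`--supports stmt-BirchSwinnertonDyer-24277`).
THEOREMS ONLY: no definition, no named fact, no `sorry`; no item is closed; BSD is not proved by this.

The adaptive telescope (`KolyvaginAdaptiveData.card_mul_card_le_of_casselsTate_adaptive`, p673519)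
consumes the binder `hCeb₂` in ORDER form: pool `⟨T⟩` zero at `λ`, `g₁` FULL at `λ` (if `g₁ ≠ 0`),
`g₂` of local order `≥ 2^I` (if `I ≥ 1`). Its discharge at `2` (T4c) = the realisability criterion of
seat g12 (`KolyvaginAdaptiveTwo.exists_characters_of_not_mem_add`, p670347: characters
`ψ₁, ψ₂ : C → ℤ/2^M`) + the Čebotarev leaf for dependent families (p669091, a homomorphism
`ψ : C → E[2^M]` with `[x, F] = ν τψ(x) + ψ(x)`) + a REGULAR element `m₀ ∈ E[2^M]`
(`ψ := ψ₁ m₀ + σ₀ψ₂ τm₀`). This file is the Galois-free algebra of that composition: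

* `exists_characters_optional` — the criterion with BOTH conditions OPTIONAL (`Pb`: "`g₁ ≠ 0`",
  `Pc`: "`I ≥ 1`"): the degenerate cases are absorbed by an auxiliary factor `ℤ/2`
  (`C × ℤ/2`, dummy class `(0, 1)` whose bottom avoids `Zp × 0 + Zm × 0` trivially);
* `conj_smul_eval_add_eval` — the EVALUATION IDENTITY: for `A, B : ℤ/2^M → E` exchanged by the
  involution `τ` (`τA = B`, `τB = A`; `A a = a m₀`, `B a = a τm₀`) and `ψ = Aψ₁ + Bψ₂`, a class of sign
  `ν` has `ν τψ(x) + ψ(x) = (A + νB)((ψ₁ + νψ₂)(x))`: the single character `χ_ν = ψ₁ + νψ₂` read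
  through the single map `L_ν = A + νB` (injective iff `m₀ + ν τm₀` has order `2^M`);
* `zsmul_ne_zero_of_addOrderOf_eq_two_pow`, `zsmul_ne_zero_of_zsmul_ne_zero_of_le` — the order
  bookkeeping turning "`ord χ(b) = ord b = 2^e`" / "`χ(2^{I−1} c) ≠ 0`" into the non-vanishing of
  `2^j χ(b)` (`j < e`) / `2^i χ(c)` (`i < I`);
* `lift_injective_of_order` — `a ↦ a • m` (`ℤ/2^M → E`) is injective when `k • m = 0 ⟹ 2^M ∣ k`.

References: [McCallumLMS1991] §3 Prop. 3.1, Cor. 3.2; §5 Thm. 5.4 (21)–(23) (PDF pp. 279–280, 289).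
-/

-- single-conjunct summit: `Summit.BirchSwinnertonDyer.BirchSwinnertonDyer.…` repeats the name by design
set_option linter.dupNamespace false
set_option autoImplicit false

namespace Summit.BirchSwinnertonDyer.BirchSwinnertonDyer.Theorems.KolyvaginCebotarevTwo

open KolyvaginAdaptiveTwo (exists_characters_of_not_mem_add)

/-! ## §1 The criterion with optional conditions -/

section Characters

variable {C : Type*} [AddCommGroup C]

/-- An element of `Z × 0 ⊆ C × ℤ/2` has second coordinate `0`. [folklore] -/
private theorem snd_eq_zero_of_mem_map (Z : AddSubgroup C) {u : C × ZMod 2}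
    (hu : u ∈ Z.map (AddMonoidHom.inl C (ZMod 2))) : u.2 = 0 := by
  obtain ⟨u₀, -, rfl⟩ := AddSubgroup.mem_map.mp hu
  rfl

/-- The dummy class `(0, 1) ∈ C × ℤ/2` is not in `Z × 0 + Z' × 0`. [folklore] -/
private theorem dummy_ne_add (Zp Zm : AddSubgroup C) :
    ∀ u ∈ Zp.map (AddMonoidHom.inl C (ZMod 2)), ∀ v ∈ Zm.map (AddMonoidHom.inl C (ZMod 2)),
      ((0, 1) : C × ZMod 2) ≠ u + v := by
  intro u hu v hv h
  have h2 := congrArg Prod.snd h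
  rw [Prod.snd_add, snd_eq_zero_of_mem_map Zp hu, snd_eq_zero_of_mem_map Zm hv, add_zero] at h2
  exact one_ne_zero h2

/-- The dummy class has order `2` and is its own bottom. [folklore] -/
private theorem dummy_bottom : (addOrderOf ((0, 1) : C × ZMod 2) / 2) • ((0, 1) : C × ZMod 2) = (0, 1) := by
  rw [Prod.addOrderOf_mk, addOrderOf_zero, ZMod.addOrderOf_one, Nat.lcm_one_left,
    Nat.div_self two_pos, one_smul]

/-- `ord (b, 0) = ord b` in `C × ℤ/2`. [folklore] -/
private theorem addOrderOf_inl (b : C) : addOrderOf ((b, 0) : C × ZMod 2) = addOrderOf b := by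
  rw [Prod.addOrderOf_mk, addOrderOf_zero, Nat.lcm_one_right]

/-- **McCallum's Cor. 3.2 at `2`, relative form, with OPTIONAL conditions.** `C` finite killed by
`2^M` (`M ≥ 1`), pools `Zp, Zm ≤ C`, classes `b, c`, flags `Pb, Pc`. If (when `Pc`) `c ∉ Zp + Zm[2]`
and (when `Pb`) `b ≠ 0` with bottom `∉ Zp[2] + Zm[2]`, then there are `ψ₁, ψ₂ : C → ℤ/2^M` with
`ψ₁ + ψ₂` killing `Zp`, `ψ₁ − ψ₂` killing `Zm`, `(ψ₁ + ψ₂)(c) ≠ 0` (when `Pc`) and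
`ord (ψ₁ − ψ₂)(b) = ord b` (when `Pb`). Proof: g12's criterion in `C × ℤ/2` with the dummy class
`(0, 1)` standing in for an absent `b` or `c`. [cite: McCallumLMS1991, §3 Cor. 3.2; §5 Thm. 5.4 (21)–(23)] -/
theorem exists_characters_optional [Finite C] {M : ℕ} (hM : 1 ≤ M) (hC : ∀ x : C, 2 ^ M • x = 0)
    (Zp Zm : AddSubgroup C) (b c : C) (Pb Pc : Prop)
    (hcA : Pc → ∀ u ∈ Zp, ∀ v ∈ Zm, 2 • v = 0 → c ≠ u + v)
    (hb : Pb → b ≠ 0)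
    (hB : Pb → ∀ u ∈ Zp, ∀ v ∈ Zm, 2 • u = 0 → 2 • v = 0 → (addOrderOf b / 2) • b ≠ u + v) :
    ∃ ψ₁ ψ₂ : C →+ ZMod (2 ^ M),
      (∀ u ∈ Zp, ψ₁ u + ψ₂ u = 0) ∧ (∀ v ∈ Zm, ψ₁ v - ψ₂ v = 0) ∧
      (Pc → ψ₁ c + ψ₂ c ≠ 0) ∧ (Pb → addOrderOf (ψ₁ b - ψ₂ b) = addOrderOf b) := by
  classical
  -- the auxiliary group `C' = C × ℤ/2`
  have hC' : ∀ x : C × ZMod 2, 2 ^ M • x = 0 := by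
    intro x
    refine Prod.ext (hC x.1) ?_
    change 2 ^ M • x.2 = 0
    rw [nsmul_eq_mul, show ((2 ^ M : ℕ) : ZMod 2) = 0 from
      (ZMod.natCast_eq_zero_iff _ _).mpr (dvd_pow_self 2 (by omega)), zero_mul]
  set inl : C →+ C × ZMod 2 := AddMonoidHom.inl C (ZMod 2) with hinl
  set Zp' : AddSubgroup (C × ZMod 2) := Zp.map inl with hZp'
  set Zm' : AddSubgroup (C × ZMod 2) := Zm.map inl with hZm'
  -- the genuine classes in `C'` and their conditions
  have hcA' : Pc → ∀ u ∈ Zp', ∀ v ∈ Zm', 2 • v = 0 → ((c, 0) : C × ZMod 2) ≠ u + v := by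
    intro hPc u hu v hv h2v h
    obtain ⟨u₀, hu₀, rfl⟩ := AddSubgroup.mem_map.mp hu
    obtain ⟨v₀, hv₀, rfl⟩ := AddSubgroup.mem_map.mp hv
    have h2v₀ : 2 • v₀ = 0 := by simpa [hinl] using congrArg Prod.fst h2v
    exact hcA hPc u₀ hu₀ v₀ hv₀ h2v₀ (by simpa [hinl] using congrArg Prod.fst h)
  have hB' : Pb → ∀ u ∈ Zp', ∀ v ∈ Zm', 2 • u = 0 → 2 • v = 0 →
      (addOrderOf ((b, 0) : C × ZMod 2) / 2) • ((b, 0) : C × ZMod 2) ≠ u + v := by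
    intro hPb u hu v hv h2u h2v h
    obtain ⟨u₀, hu₀, rfl⟩ := AddSubgroup.mem_map.mp hu
    obtain ⟨v₀, hv₀, rfl⟩ := AddSubgroup.mem_map.mp hv
    have h2u₀ : 2 • u₀ = 0 := by simpa [hinl] using congrArg Prod.fst h2u
    have h2v₀ : 2 • v₀ = 0 := by simpa [hinl] using congrArg Prod.fst h2v
    rw [addOrderOf_inl] at h
    exact hB hPb u₀ hu₀ v₀ hv₀ h2u₀ h2v₀ (by simpa [hinl] using congrArg Prod.fst h)
  have hb' : Pb → ((b, 0) : C × ZMod 2) ≠ 0 := fun hPb h ↦ hb hPb (congrArg Prod.fst h)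
  have hd0 : ((0, 1) : C × ZMod 2) ≠ 0 := fun h ↦ one_ne_zero (congrArg Prod.snd h)
  have hdA : ∀ u ∈ Zp', ∀ v ∈ Zm', 2 • v = 0 → ((0, 1) : C × ZMod 2) ≠ u + v :=
    fun u hu v hv _ ↦ dummy_ne_add Zp Zm u hu v hv
  have hdB : ∀ u ∈ Zp', ∀ v ∈ Zm', 2 • u = 0 → 2 • v = 0 →
      (addOrderOf ((0, 1) : C × ZMod 2) / 2) • ((0, 1) : C × ZMod 2) ≠ u + v := by
    intro u hu v hv _ _
    rw [dummy_bottom]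
    exact dummy_ne_add Zp Zm u hu v hv
  -- choose `b'`, `c'` according to the flags and run the criterion in `C'`
  have key : ∃ ψ₁' ψ₂' : C × ZMod 2 →+ ZMod (2 ^ M),
      (∀ u ∈ Zp', ψ₁' u + ψ₂' u = 0) ∧ (∀ v ∈ Zm', ψ₁' v - ψ₂' v = 0) ∧
      (Pc → ψ₁' (c, 0) + ψ₂' (c, 0) ≠ 0) ∧
      (Pb → addOrderOf (ψ₁' (b, 0) - ψ₂' (b, 0)) = addOrderOf ((b, 0) : C × ZMod 2)) := by
    by_cases hPb : Pb <;> by_cases hPc : Pc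
    · obtain ⟨ψ₁', ψ₂', h1, h2, h3, h4⟩ :=
        exists_characters_of_not_mem_add hC' Zp' Zm' (hb' hPb) (hcA' hPc) (hB' hPb)
      exact ⟨ψ₁', ψ₂', h1, h2, fun _ ↦ h3, fun _ ↦ h4⟩
    · obtain ⟨ψ₁', ψ₂', h1, h2, -, h4⟩ :=
        exists_characters_of_not_mem_add hC' Zp' Zm' (hb' hPb) hdA (hB' hPb)
      exact ⟨ψ₁', ψ₂', h1, h2, fun h ↦ (hPc h).elim, fun _ ↦ h4⟩
    · obtain ⟨ψ₁', ψ₂', h1, h2, h3, -⟩ :=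
        exists_characters_of_not_mem_add hC' Zp' Zm' hd0 (hcA' hPc) hdB
      exact ⟨ψ₁', ψ₂', h1, h2, fun _ ↦ h3, fun h ↦ (hPb h).elim⟩
    · exact ⟨0, 0, fun _ _ ↦ by simp, fun _ _ ↦ by simp, fun h ↦ (hPc h).elim, fun h ↦ (hPb h).elim⟩
  obtain ⟨ψ₁', ψ₂', h1, h2, h3, h4⟩ := key
  refine ⟨ψ₁'.comp inl, ψ₂'.comp inl, ?_, ?_, ?_, ?_⟩
  · intro u hu
    exact h1 _ (AddSubgroup.mem_map_of_mem _ hu)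
  · intro v hv
    exact h2 _ (AddSubgroup.mem_map_of_mem _ hv)
  · intro hPc
    exact h3 hPc
  · intro hPb
    rw [AddMonoidHom.comp_apply, AddMonoidHom.comp_apply, hinl, AddMonoidHom.inl_apply, h4 hPb,
      addOrderOf_inl]

end Characters

/-! ## §2 The evaluation identity and the order bookkeeping -/

section Eval

variable {E : Type*} [AddCommGroup E] {C : Type*} [AddCommGroup C] {n : ℕ}

/-- **The evaluation identity.** If `τ` exchanges `A` and `B` (`τ ∘ A = B`, `τ ∘ B = A`) and
`ψ = A ∘ ψ₁ + B ∘ ψ₂`, then for a sign `ν = ±1`: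
`ν • τ(ψ x) + ψ x = (A + ν • B)((ψ₁ + ν • ψ₂) x)` — the value `[x, F] = ν τψ(x) + ψ(x)` of a
`ν`-eigenclass at a Kolyvagin prime (McCallum's (2)–(3) at `2`, leaf p669091) is the single character
`χ_ν = ψ₁ + νψ₂` read through the single map `L_ν = A + νB`.
[cite: McCallumLMS1991, §3 (2), (3), Prop. 3.1 (PDF pp. 279–280)] -/
theorem conj_smul_eval_add_eval (A B : ZMod n →+ E) (τ : E →+ E) (hA : ∀ a, τ (A a) = B a)
    (hB : ∀ a, τ (B a) = A a) (ψ₁ ψ₂ : C →+ ZMod n) {ν : ℤ} (hν : ν = 1 ∨ ν = -1) (x : C) :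
    ν • τ ((A.comp ψ₁ + B.comp ψ₂) x) + (A.comp ψ₁ + B.comp ψ₂) x =
      (A + ν • B) ((ψ₁ + ν • ψ₂) x) := by
  simp only [AddMonoidHom.add_apply, AddMonoidHom.comp_apply, map_add, hA, hB,
    AddMonoidHom.smul_apply, map_zsmul]
  rcases hν with rfl | rfl
  · simp only [one_zsmul]
    abel
  · simp only [neg_one_zsmul, neg_add_rev, neg_neg]
    abel

/-- `a ↦ a • m` on `ℤ/n` (`ZMod.lift` of `k ↦ k • m`) is injective when `k • m = 0 ⟹ n ∣ k`.
[folklore] -/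
theorem lift_injective_of_order [NeZero n] (m : E) (hm0 : (n : ℤ) • m = 0)
    (hm : ∀ k : ℤ, k • m = 0 → (n : ℤ) ∣ k) (a : ZMod n)
    (ha : ZMod.lift n ⟨zmultiplesHom E m, by simpa using hm0⟩ a = 0) : a = 0 := by
  rw [← ZMod.intCast_zmod_cast a] at ha ⊢
  rw [ZMod.lift_coe] at ha
  change (ZMod.cast a : ℤ) • m = 0 at ha
  exact (ZMod.intCast_zmod_eq_zero_iff_dvd _ n).mpr (hm _ ha)

/-- If `ord y = 2^e` and `j < e` then `2^j • y ≠ 0`. [folklore] -/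
theorem zsmul_ne_zero_of_addOrderOf_eq_two_pow {G : Type*} [AddCommGroup G] {y : G} {e j : ℕ}
    (hy : addOrderOf y = 2 ^ e) (hj : j < e) : (((2 : ℕ) : ℤ) ^ j) • y ≠ 0 := by
  intro h
  rw [← Nat.cast_pow, natCast_zsmul] at h
  have hdvd := addOrderOf_dvd_of_nsmul_eq_zero h
  rw [hy, Nat.pow_dvd_pow_iff_le_right Nat.one_lt_two] at hdvd
  omega

/-- If `2^{I-1} • y ≠ 0` and `i < I` then `2^i • y ≠ 0`. [folklore] -/
theorem zsmul_ne_zero_of_zsmul_ne_zero_of_lt {G : Type*} [AddCommGroup G] {y : G} {I i : ℕ}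
    (hy : (((2 : ℕ) : ℤ) ^ (I - 1)) • y ≠ 0) (hi : i < I) : (((2 : ℕ) : ℤ) ^ i) • y ≠ 0 := by
  intro h
  apply hy
  obtain ⟨k, hk⟩ := Nat.exists_eq_add_of_le (Nat.le_sub_one_of_lt hi)
  rw [hk, add_comm, pow_add, mul_zsmul, h, zsmul_zero]

end Eval

end Summit.BirchSwinnertonDyer.BirchSwinnertonDyer.Theorems.KolyvaginCebotarevTwo
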